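import Literature.NumberTheory.Automorphic.RankOneRelations
import HarnessLib

/-!
# From the relations (19), (20) to an `SL₂`-realisation (Springer 7.3.5, 8.1.4 (i))
(trunk T-AUTOMORPHIC, G25 AutomorphicL)

Companion to `RankOneRelations.lean` (Springer 7.2.4: the homomorphism `φ = lift : SL₂ → G`
attached to one-parameter subgroups `u, t`, a Weyl element `n` and the multiplication rules
(19), (20)) and to `ReductiveDualRootDatum.lean` (`IsSL2Realization`: the datum realising a root
and its coroot, whose existence root by root is the named fact `exists_sl2Realization_of_central`
of `ReductiveDualRankOne.lean`, Springer 8.1.4 (i)). Proved here: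

* `RankOneRelations.isSL2Realization` — if `u` is a root homomorphism for `α` relative to a torus
  `T ≤ G ≤ GL N`, `t = tT : 𝔾ₘ → T`, `n` normalises `T` through `σ` with `α ∘ σ = -α`, the rules
  (19), (20) hold, **and `φ` is algebraic**, then `φ` is an `SL₂`-realisation of `(α, α^∨)` with
  `α^∨(y) = tT(y^{m'})` (Springer 7.3.5 (i): `α^∨` is the image of the diagonal torus; 8.1.4 (i),
  proof: reduction to `SL₂`). The lower root group is handled by `lift_unipotentLowerSL2`
  (`φ(u₁⁻(x)) = n u(-x) n⁻¹`) and `IsRootHom.conj` (conjugates of root homomorphisms by `N_G(T)`).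
* `IsAlgebraicCochar.comp_powMonoidHom` — `y ↦ γ(y^e)` is an algebraic cocharacter when `γ` is
  (so that `α^∨ ∈ X_*(T)`).

Thus the named fact `exists_sl2Realization_of_central` is reduced to producing, inside
`G_α = Z_G((Ker α)°)`, the data `(u, tT, n, m, m')` with (19), (20) (Springer 7.2.2–7.2.3 and the
first page of the proof of 7.2.4: the structure theory of semisimple rank one) and to the
algebraicity of `φ` (a local statement on the Bruhat cells of `SL₂`).

## References

* [SpringerLAG1998] T. A. Springer, *Linear Algebraic Groups*, 2nd ed., Progress in Mathematics 9,
  Birkhäuser (1998): 7.2.4, 7.3.3, 7.3.5 (i), 8.1.1 (i), 8.1.4 (i).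
-/

open scoped MatrixGroups
open Multiplicative (ofAdd)

namespace Literature.NumberTheory.Automorphic

variable {k : Type*} [Field k] {N : Type*} [Fintype N] [DecidableEq N]

/-- Precomposing an algebraic cocharacter with `y ↦ y ^ e` gives an algebraic cocharacter
(Springer 3.2.1: `X_*` is stable under multiplication by integers). [folklore] -/
theorem IsAlgebraicCochar.comp_powMonoidHom {T : Subgroup (GL N k)} {γ : kˣ →* ↥T}
    (hγ : IsAlgebraicCochar γ) (e : ℕ) : IsAlgebraicCochar (γ.comp (powMonoidHom e)) := by
  obtain ⟨P, hP⟩ := hγ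
  refine ⟨fun c => MvPolynomial.bind₁ ![MvPolynomial.X 0 ^ e, MvPolynomial.X 1 ^ e] (P c),
    fun x c => ?_⟩
  rw [MonoidHom.comp_apply, powMonoidHom_apply, hP, eval_bind₁]
  congr 2
  funext i
  fin_cases i <;> simp [inv_pow]

variable {G T : Subgroup (GL N k)} {hTG : T ≤ G} {α : ↥T →* kˣ} {u : Multiplicative k →* ↥G}
  {tT : kˣ →* ↥T} {n : ↥G} {m m' : ℕ}

/-- **From Springer's relations to an `SL₂`-realisation** (the bookkeeping of 7.3.3, 7.3.5 and
8.1.4 (i), proof: "*we reduce the proof of (i) to the case that `G = SL₂`*"). Let `u` be a root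
homomorphism for `α`, `tT : 𝔾ₘ → T` a cocharacter and `n ∈ G` an element normalising
`T` through an automorphism `σ` with `α ∘ σ = -α`, such that `(u, tT, n)` satisfy the
multiplication rules (19), (20) (`RankOneRelations`). If the homomorphism `φ = lift : SL₂ → G`
they define (`RankOneRelations.lift`, 7.2.4) is algebraic, then `φ` realises `(α, α^∨)` with
`α^∨(y) = tT(y^{m'})` (`IsSL2Realization`; `α^∨` is algebraic when `tT` is,
`IsAlgebraicCochar.comp_powMonoidHom`): `φ ∘ u₁ = u`, `φ ∘ u₁⁻ = Int(n) ∘ u ∘ (-1)` is a root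
homomorphism for `α ∘ σ = -α`, and `φ(diag(y, y⁻¹)) = tT(y^{m'})`. The algebraicity of `φ` is
Springer's "*the restriction of `φ` to `V` [and to its translates] is a morphism … it follows that
`φ` is a homomorphism of algebraic groups*". [cite: SpringerLAG1998, 8.1.4 (i) (proof) with 7.2.4, 7.3.5] -/
theorem RankOneRelations.isSL2Realization
    (h : RankOneRelations u ((Subgroup.inclusion hTG).comp tT) n m m')
    (hu : IsRootHom G T hTG α u) {σ : ↥T ≃* ↥T}
    (hn : ∀ s : ↥T, n⁻¹ * Subgroup.inclusion hTG s * n = Subgroup.inclusion hTG (σ s))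
    (hα : α.comp σ.toMonoidHom = α⁻¹) (halg : IsAlgebraicSL2Hom h.lift) :
    IsSL2Realization G T hTG α (tT.comp (powMonoidHom m')) h.lift := by
  refine ⟨halg, ?_, ?_, fun y => ?_⟩
  · -- `φ ∘ u₁ = u`
    have he : h.lift.comp unipotentUpperSL2 = u := by
      refine MonoidHom.ext fun x => ?_
      rw [MonoidHom.comp_apply, ← ofAdd_toAdd x, h.lift_unipotentUpperSL2]
    rw [he]
    exact hu
  · -- `φ ∘ u₁⁻ = Int(n) ∘ u ∘ (-1)`, a root homomorphism for `α ∘ σ = α⁻¹`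
    have h1 := (hu.comp_mulLeft (-1)).conj (m := n) hn
    rw [hα] at h1
    have he : h.lift.comp unipotentLowerSL2 =
        (MulAut.conj n).toMonoidHom.comp
          (u.comp (AddMonoidHom.toMultiplicative
            (DistribSMul.toAddMonoidHom k (((-1 : kˣ) : k))))) := by
      refine MonoidHom.ext fun x => ?_
      rw [MonoidHom.comp_apply, ← ofAdd_toAdd x, h.lift_unipotentLowerSL2]
      simp [MulAut.conj_apply]
    rw [he]
    exact h1
  · rw [h.lift_diagSL2]
    rfl

end Literature.NumberTheory.Automorphic
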